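import Mathlib
import HarnessLib
import Literature.MathematicalPhysics.QuantumLattice.HubbardHubbardModelEtaPairingProofs
import Summits.HubbardSuperconductivity.HubbardSuperconductivity.Theorems.WeakCouplingBCSWcbcsBcsConstructionGcGroundEnergyEqMin

/-!
# Route `ThermalWedge`, item `stmt-HubbardSuperconductivity-1702` (`TwPureThermalBound`):
# grand-canonical minimizing sectors of the Hubbard torus

Support file (`--supports stmt-HubbardSuperconductivity-1702`; no definition; the route file is NOT
imported). For the torus `(ℤ/Lℤ)²` write `E_L(N) = groundEnergyAt (fermionTorusGraph 2 L) 1 U N` for the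
sector ground-state energies and `G_L(μ) = E₀(hubbardTorusWith 2 L 1 U μ)` for the grand-canonical ground
energy. Since `G_L(μ) = min_{N ≤ 2L²} (E_L(N) − μN)` (`stub_gcGroundEnergyEqMin`, tree), we record the
elementary convex-duality facts the `T = 0` equivalence-of-ensembles argument (GC MIXING) consumes:

* `ptbm_gc_le`: `G_L(μ) ≤ E_L(N) − μN` for every `N ≤ 2L²`;
* `ptbm_gc_exists_minimizer`: a minimizing sector `N* ≤ 2L²` with `E_L(N*) − μN* = G_L(μ)` exists;
* `ptbm_minimizer_mono`: minimizers are monotone in `μ` — if `N` minimizes at `μ` and `N'` at `μ' > μ`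
  then `N ≤ N'` (add the two minimality inequalities);
* `ptbm_mul_minimizer_le` / `ptbm_le_mul_minimizer`: the supergradient sandwich
  `G_L(μ−h) − G_L(μ) ≤ h N* ≤ G_L(μ) − G_L(μ+h)` (the particle number of a minimizer is a supergradient
  of the concave `μ ↦ G_L(μ)`); `ptbm_minimizer_energy`: `E_L(N*) = G_L(μ) + μN*`.

Ruelle, *Statistical Mechanics: Rigorous Results* (1969), §3.4 (chemical potential vs. density);
Griffiths, J. Math. Phys. 5 (1964) 1215. Everything here is finite-dimensional and [folklore].
-/

set_option linter.dupNamespace false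

noncomputable section

namespace Summit.HubbardSuperconductivity.HubbardSuperconductivity.Theorems

open Literature.MathematicalPhysics.QuantumLattice Literature.Probability.LatticeModels Matrix Finset
open scoped ComplexOrder

/-- **The grand-canonical ground energy is below every sector line**: `G_L(μ) ≤ E_L(N) − μN` for
`N ≤ 2L²`. [folklore] -/
theorem ptbm_gc_le (L : ℕ) (U μ : ℝ) {N : ℕ} (hN : N ≤ 2 * L ^ 2) :
    (hubbardTorusWith 2 L 1 U μ).groundEnergy ≤
      groundEnergyAt (fermionTorusGraph 2 L) 1 U N - μ * N := by
  have hN' : N ≤ 2 * Fintype.card (FermionTorus 2 L) := by rwa [card_fermionTorus 2]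
  have h := WcbcsGcGroundEnergy.groundEnergy_le_groundEnergyAt_sub (fermionTorusGraph 2 L) 1 U μ hN'
  unfold hubbardTorusWith
  convert h using 2

/-- **The grand-canonical minimum is attained**: some sector `N* ≤ 2L²` has
`E_L(N*) − μN* = G_L(μ)`. [folklore] -/
theorem ptbm_gc_exists_minimizer (L : ℕ) (U μ : ℝ) :
    ∃ N : ℕ, N ≤ 2 * L ^ 2 ∧
      groundEnergyAt (fermionTorusGraph 2 L) 1 U N - μ * N = (hubbardTorusWith 2 L 1 U μ).groundEnergy := by
  have hT : (hubbardTorusWith 2 L 1 U μ).groundEnergy =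
      ⨅ N : Fin (2 * Fintype.card (FermionTorus 2 L) + 1),
        (groundEnergyAt (fermionTorusGraph 2 L) 1 U (N : ℕ) - μ * ((N : ℕ) : ℝ)) := by
    unfold hubbardTorusWith
    convert stub_gcGroundEnergyEqMin (fermionTorusGraph 2 L) 1 U μ using 2
  obtain ⟨N, hN⟩ := exists_eq_ciInf_of_finite
    (f := fun N : Fin (2 * Fintype.card (FermionTorus 2 L) + 1) =>
      groundEnergyAt (fermionTorusGraph 2 L) 1 U (N : ℕ) - μ * ((N : ℕ) : ℝ))
  refine ⟨N, ?_, ?_⟩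
  · have h1 := N.isLt
    have hc : 2 * Fintype.card (FermionTorus 2 L) = 2 * L ^ 2 := by rw [card_fermionTorus]
    omega
  · rw [hT, ← hN]

/-- **Minimizing sectors are monotone in the chemical potential**: if `N` minimizes `E_L(·) − μ ·` and
`N'` minimizes `E_L(·) − μ' ·` with `μ < μ'`, then `N ≤ N'` (add the two minimality inequalities:
`(μ' − μ)(N − N') ≤ 0`). [folklore] -/
theorem ptbm_minimizer_mono (L : ℕ) (U : ℝ) {μ μ' : ℝ} (hμ : μ < μ') {N N' : ℕ} (hN : N ≤ 2 * L ^ 2)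
    (hN' : N' ≤ 2 * L ^ 2)
    (hmin : groundEnergyAt (fermionTorusGraph 2 L) 1 U N - μ * N = (hubbardTorusWith 2 L 1 U μ).groundEnergy)
    (hmin' : groundEnergyAt (fermionTorusGraph 2 L) 1 U N' - μ' * N' =
      (hubbardTorusWith 2 L 1 U μ').groundEnergy) :
    N ≤ N' := by
  have h1 := ptbm_gc_le L U μ hN'
  have h2 := ptbm_gc_le L U μ' hN
  rw [← hmin] at h1
  rw [← hmin'] at h2
  -- `(μ' - μ) (N - N') ≤ 0`
  have h3 : (μ' - μ) * ((N : ℝ) - N') ≤ 0 := by nlinarith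
  have h4 : (N : ℝ) - N' ≤ 0 := by
    by_contra h
    push Not at h
    have : 0 < (μ' - μ) * ((N : ℝ) - N') := mul_pos (sub_pos.2 hμ) h
    linarith
  exact_mod_cast (sub_nonpos.1 h4)

/-- **Supergradient sandwich, upper**: for a minimizing sector `N*` at `μ` and `h ≥ 0`,
`h N* ≤ G_L(μ) − G_L(μ + h)` (`N*` is a trial sector at `μ + h`). [folklore] -/
theorem ptbm_mul_minimizer_le (L : ℕ) (U μ : ℝ) {h : ℝ} {N : ℕ} (hN : N ≤ 2 * L ^ 2)
    (hmin : groundEnergyAt (fermionTorusGraph 2 L) 1 U N - μ * N = (hubbardTorusWith 2 L 1 U μ).groundEnergy) :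
    h * N ≤ (hubbardTorusWith 2 L 1 U μ).groundEnergy - (hubbardTorusWith 2 L 1 U (μ + h)).groundEnergy := by
  have h1 := ptbm_gc_le L U (μ + h) hN
  rw [← hmin]
  linarith

/-- **Supergradient sandwich, lower**: for a minimizing sector `N*` at `μ` and any `h`,
`G_L(μ − h) − G_L(μ) ≤ h N*` (`N*` is a trial sector at `μ − h`). [folklore] -/
theorem ptbm_le_mul_minimizer (L : ℕ) (U μ : ℝ) {h : ℝ} {N : ℕ} (hN : N ≤ 2 * L ^ 2)
    (hmin : groundEnergyAt (fermionTorusGraph 2 L) 1 U N - μ * N = (hubbardTorusWith 2 L 1 U μ).groundEnergy) :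
    (hubbardTorusWith 2 L 1 U (μ - h)).groundEnergy - (hubbardTorusWith 2 L 1 U μ).groundEnergy ≤ h * N := by
  have h1 := ptbm_gc_le L U (μ - h) hN
  rw [← hmin]
  linarith

/-- **Energy of a minimizing sector**: `E_L(N*) = G_L(μ) + μ N*`. [folklore] -/
theorem ptbm_minimizer_energy (L : ℕ) (U μ : ℝ) {N : ℕ}
    (hmin : groundEnergyAt (fermionTorusGraph 2 L) 1 U N - μ * N = (hubbardTorusWith 2 L 1 U μ).groundEnergy) :
    groundEnergyAt (fermionTorusGraph 2 L) 1 U N = (hubbardTorusWith 2 L 1 U μ).groundEnergy + μ * N := by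
  linarith

end Summit.HubbardSuperconductivity.HubbardSuperconductivity.Theorems

end
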